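import Literature.Analysis.OperatorTheory.YangMillsMatrixModelRotationAverage
import Literature.Analysis.OperatorTheory.YangMillsMatrixModelWeakEigenbasis
import HarnessLib

/-!
# AL1, steps N1–N4: a smooth, `SO(3)`-invariant, `L²`-orthonormal eigenbasis of Lüscher's Hamiltonian realising `physLevel`

Topic `Literature/Analysis/OperatorTheory`; the join of
`YangMillsMatrixModelWeakEigenbasis.lean` (N1 + N2: `exists_weakEigenbasis_physLevel`, the variational
weak eigenbasis — Reed–Simon IV Thm XIII.64 (iv)⇒(v) + XIII.2 on the invariant form core) with
`YangMillsMatrixModelRotationAverage.lean` (N3: `SO(3)`-averaging) and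
`YangMillsMatrixModelWeakSolutions.lean` (N4: interior elliptic regularity):

* ★ `exists_smooth_invariant_eigenseq` — there are `f₀, f₁, … ∈ C^∞(ℝ⁹) ∩ L²`, each `SO(3)`-invariant,
  `L²`-orthonormal, with `𝔥 f_k = physLevel (k+1) · f_k` pointwise — dictionary items (1)–(3) of the named
  fact `LuscherHamiltonianEigenfunctions` (`YangMillsMatrixModelEigenfunctions.lean`) for EVERY level;
* `exists_smooth_invariant_eigenfamily k` — the same for the first `k+1` levels, `Fin (k+1)`-indexed as in AL1;
* `luscherHamiltonianEigenfunctions_of_decay` — AL1 `k` follows from the remaining step N5 alone: pointwise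
  exponential decay `ExpDecay₂` of smooth `L²` solutions of `𝔥f = Ef` (Agmon).

Theorems only; no definitions, no named facts.

## References
* [ReedSimonIV1978] M. Reed, B. Simon, *Methods of Modern Mathematical Physics IV*, Thm. XIII.64, Thm. XIII.2,
  §XIII.12.
* [LiebLoss2001] E. H. Lieb, M. Loss, *Analysis*, 2nd ed., Thm. 11.7–11.9.
* [Agmon1982] S. Agmon, *Lectures on Exponential Decay*, Cor. 4.5, Thm. 5.1 (the decay step N5, not used here).
-/

noncomputable section

open MeasureTheory
open scoped ContDiff

namespace Literature.Analysis.OperatorTheory.YMMatrixModel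

/-- ★ **AL1 N1–N4 for every level.**  There is a sequence `f : ℕ → (ℝ⁹ → ℝ)` of smooth (`C^n` for all
`n`), `SO(3)`-invariant, `L²`-orthonormal functions in `L²(ℝ⁹)` solving `𝔥 f_k = physLevel (k+1) · f_k`
classically: the weak min–max eigenbasis of `exists_weakEigenbasis_physLevel` made smooth and pointwise
invariant by `smooth_gaugeInv_eigenseq_of_weak`. [cite: ReedSimonIV1978, Thm. XIII.64 and §XIII.12] [cite: LiebLoss2001, Thm. 11.7–11.9] -/
theorem exists_smooth_invariant_eigenseq :
    ∃ f : ℕ → ZM → ℝ, (∀ k (n : ℕ∞), ContDiff ℝ n (f k)) ∧ (∀ k, IsGaugeInv (f k)) ∧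
      (∀ i j, ∫ x, f i x * f j x = if i = j then (1 : ℝ) else 0) ∧
      (∀ k x, hApply (f k) x = physLevel (k + 1) * f k x) ∧ (∀ k, MemLp (f k) 2 volume) := by
  obtain ⟨u, hon, hcl, hweak⟩ := exists_weakEigenbasis_physLevel
  obtain ⟨f, hf, hfi, horth, hfE, hf2, -⟩ := smooth_gaugeInv_eigenseq_of_weak u hon hcl hweak
  exact ⟨f, hf, hfi, horth, hfE, hf2⟩

/-- **AL1 N1–N4, `Fin (k+1)`-indexed** (the shape of `LuscherHamiltonianEigenfunctions k` without the decay
clause). [cite: ReedSimonIV1978, Thm. XIII.64 and §XIII.12] -/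
theorem exists_smooth_invariant_eigenfamily (k : ℕ) :
    ∃ f : Fin (k + 1) → ZM → ℝ, (∀ j, ∀ n : ℕ∞, ContDiff ℝ n (f j)) ∧ (∀ j, IsGaugeInv (f j)) ∧
      (∀ i j, ∫ x, f i x * f j x = if i = j then (1 : ℝ) else 0) ∧
      (∀ j, ∀ x : ZM, hApply (f j) x = physLevel ((j : ℕ) + 1) * f j x) ∧
      (∀ j, MemLp (f j) 2 volume) := by
  obtain ⟨f, hf, hfi, horth, hfE, hf2⟩ := exists_smooth_invariant_eigenseq
  refine ⟨fun j => f j, fun j => hf j, fun j => hfi j, fun i j => ?_, fun j => hfE j, fun j => hf2 j⟩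
  rw [horth]
  exact if_congr Fin.val_inj rfl rfl

/-- **AL1 from the decay step alone.**  If every smooth `L²` solution of `𝔥f = Ef` on `ℝ⁹` has the pointwise
exponential decay `ExpDecay₂` (Agmon's estimate, step N5), then `LuscherHamiltonianEigenfunctions k` holds
for every `k`. [cite: ReedSimonIV1978, Thm. XIII.64] [cite: Agmon1982, Cor. 4.5, Thm. 5.1] -/
theorem luscherHamiltonianEigenfunctions_of_decay
    (hdecay : ∀ (E : ℝ) (f : ZM → ℝ), (∀ n : ℕ∞, ContDiff ℝ n f) → MemLp f 2 volume →
      (∀ x, hApply f x = E * f x) → ExpDecay₂ f) (k : ℕ) :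
    LuscherHamiltonianEigenfunctions k := by
  obtain ⟨f, hf, hfi, horth, hfE, hf2⟩ := exists_smooth_invariant_eigenfamily k
  exact ⟨f, hf, hfi, horth, hfE, fun j => hdecay _ (f j) (hf j) (hf2 j) (hfE j)⟩

end Literature.Analysis.OperatorTheory.YMMatrixModel

end
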